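/-
Copyright: rh-split cell, seat prover-l1-w2 (L1 «DUST WALL», width seat 2), 2026-08-27.  Splitting search
over kernel-typed RH-equivalences; a splitting `A ∧ B ⟹ RH` is conditional bookkeeping unless `A` and
`B` are both proved.  Nothing here bears on the truth of RH.
-/
import Summits.RiemannHypothesis.RiemannHypothesis.Theorems.Splittings.ScrewDustCycleGauss
import Summits.RiemannHypothesis.RiemannHypothesis.Theorems.Splittings.ScrewDustZorettiGrid
import Summits.RiemannHypothesis.RiemannHypothesis.Theorems.Splittings.ScrewLatticeGauss
import HarnessLib

/-!
# The cycle row: `CEIL(h) ∧ CENC(h) ⟺ RH` — Gauss's law for grid cycles around the aliased far zeros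

Data (Suzuki 2023, `ScrewLatticeContinuation`): for a step `h > 0`, under `CEIL(h) = LatticeCeiling h`
the lattice generating function `latticeGF h` of the screw function is holomorphic on `𝔻` and equals
near `0` the sign-definite Borel series with charges `coeff ρ` and aliased zeros `mult h ρ = e^{(ρ-1/2)h}`;
the inside pole set is `aliasedPoleSet h` (nonempty iff `¬RH`), its closure the WALL `T_h`, and
`Ω₀(h) = ScrewLatticeGauss.originComponent h` is the origin's component of `𝔻 ∖ T_h`.

* `CENC(h)` (`CycleEncirclable h`, §2): if there are aliased far zeros in `𝔻`, some GRID CYCLE of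
  `Ω₀(h)` encloses one — a finite complex of closed grid cells inside `𝔻`, in general position, all of
  whose exposed edges lie in `Ω₀(h)`, with an aliased far zero in an open cell.
* **Row** (`latticeCeiling_and_cycleEncirclable_iff_rh`, §2): `CEIL(h) ∧ CENC(h) ⟺ RH` for every
  `h > 0`, by the ζ-free GAUSS LAW FOR GRID CYCLES `ScrewDust.poleSet_inter_cello_eq_empty`; RH-free
  content `latticeCeiling_dichotomy_cycles`: `CEIL(h) ⟹ RH ∨` [aliased far zeros exist and no
  wall-free grid cycle of `Ω₀(h)` encloses one].
* **A circle is a grid cycle** (`ScrewDust.exists_cellComplex_of_sphere`, §1, plane geometry): a round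
  circle inside an open set `U`, a countable set `T` to keep off the grid lines and a point `p ∈ T`
  inside the circle give a complex with cells in `closedBall ∪ U`, exposed edges in `U`, `T` in general
  position and `p` in an open cell.  Hence `ENC(h) ⟹ CENC(h)` (`cycleEncirclable_of_encirclable`, §3)
  and, with the tree's `ScrewLatticeGauss`, `LASSO(h) ⟹ CENC(h)`, `TW(h) ⟹ CENC(h)`: the cycle row
  contains the circle rows X-14 ⊇ X-13′ ⊇ X-10 ⊇ X-9.  The dust wall `TD(h)` of route `ScrewDustWall`
  (X-11) enters the same row through prover-l1's Zoretti hull (separate file).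

No `sorry`, no new axioms, no instances, no notation; one `@[conjecture] def` (`CycleEncirclable`).
-/

set_option linter.dupNamespace false

/-! ## 1. Plane geometry: a round circle inside an open set is shadowed by a grid cycle -/

namespace Summit.RiemannHypothesis.RiemannHypothesis.Theorems.Splittings.ScrewDust

open Complex Filter Topology Set Metric
open scoped Classical

/-- Radial projection: a point at distance in `[R, R + ε)` from `a` (`R > 0`) is `ε`-close to the
circle `sphere a R`. -/
theorem exists_mem_sphere_dist_lt {a z : ℂ} {R ε : ℝ} (hR : 0 < R) (hRz : R ≤ dist z a)
    (hzε : dist z a < R + ε) : ∃ z' ∈ sphere a R, dist z z' < ε := by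
  have hza : 0 < ‖z - a‖ := by rw [← dist_eq_norm]; linarith
  set t : ℝ := R / ‖z - a‖ with ht
  have ht0 : 0 < t := div_pos hR hza
  have ht1 : t ≤ 1 := by rw [ht, div_le_one hza, ← dist_eq_norm]; exact hRz
  refine ⟨a + (t : ℂ) * (z - a), ?_, ?_⟩
  · rw [mem_sphere, dist_eq_norm, add_sub_cancel_left, norm_mul, Complex.norm_real,
      Real.norm_eq_abs, abs_of_pos ht0, ht, div_mul_cancel₀ _ hza.ne']
  · rw [dist_eq_norm]
    have e : z - (a + (t : ℂ) * (z - a)) = ((1 - t : ℝ) : ℂ) * (z - a) := by push_cast; ring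
    rw [e, norm_mul, Complex.norm_real, Real.norm_eq_abs, abs_of_nonneg (by linarith), sub_mul,
      one_mul, ht, div_mul_cancel₀ _ hza.ne', ← dist_eq_norm]
    linarith

/-- A point of the open annulus `R ≤ dist z a < R + η` lies in any set containing the `η`-thickening
of the circle `sphere a R` (`R > 0`). -/
theorem mem_of_thickening_sphere_subset {a z : ℂ} {R η : ℝ} {U : Set ℂ} (hR : 0 < R)
    (hU : thickening η (sphere a R) ⊆ U) (hRz : R ≤ dist z a) (hzη : dist z a < R + η) : z ∈ U := by
  obtain ⟨z', hz', hd⟩ := exists_mem_sphere_dist_lt hR hRz hzη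
  exact hU (Metric.mem_thickening_iff.2 ⟨z', hz', hd⟩)

/-- **A circle is a grid cycle.**  Let `U` be open and contain the circle `sphere a R` (`R > 0`), let
`T` be countable and `p ∈ T` with `dist p a < R`.  Then there are a grid `x, y` (uniform, non-decreasing)
and a finite complex `H` of its closed cells with: every closed cell of `H` inside `closedBall a R ∪ U`;
`T` in general position (each point of `T` in an open cell or off the closed cell, for every cell);
every EXPOSED edge of `H` (bottom edge of a cell of `H` with no cell of `H` below it, etc.) inside `U`;
and `p` in an open cell of `H`.  (The cells of `H` are those meeting `closedBall a R`, of mesh below a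
thickening radius of the circle inside `U`, on lines avoiding `T`.) -/
theorem exists_cellComplex_of_sphere {T : Set ℂ} (hT : T.Countable) {U : Set ℂ} (hU : IsOpen U)
    {a : ℂ} {R : ℝ} (hR : 0 < R) (hSU : sphere a R ⊆ U) {p : ℂ} (hpT : p ∈ T) (hpa : dist p a < R) :
    ∃ (x y : ℤ → ℝ) (H : Finset (ℤ × ℤ)),
      (∀ m, x m ≤ x (m + 1)) ∧ (∀ n, y n ≤ y (n + 1)) ∧
      (∀ k ∈ H, Icc (x k.1) (x (k.1 + 1)) ×ℂ Icc (y k.2) (y (k.2 + 1)) ⊆ closedBall a R ∪ U) ∧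
      (∀ q ∈ T, ∀ k : ℤ × ℤ, q ∈ Ioo (x k.1) (x (k.1 + 1)) ×ℂ Ioo (y k.2) (y (k.2 + 1)) ∨
        q ∉ Icc (x k.1) (x (k.1 + 1)) ×ℂ Icc (y k.2) (y (k.2 + 1))) ∧
      (∀ k ∈ H, (k.1, k.2 - 1) ∉ H →
        (fun t : ℝ ↦ (t : ℂ) + y k.2 * I) '' Icc (x k.1) (x (k.1 + 1)) ⊆ U) ∧
      (∀ k ∈ H, (k.1, k.2 + 1) ∉ H →
        (fun t : ℝ ↦ (t : ℂ) + y (k.2 + 1) * I) '' Icc (x k.1) (x (k.1 + 1)) ⊆ U) ∧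
      (∀ k ∈ H, (k.1 - 1, k.2) ∉ H →
        (fun t : ℝ ↦ (x k.1 : ℂ) + t * I) '' Icc (y k.2) (y (k.2 + 1)) ⊆ U) ∧
      (∀ k ∈ H, (k.1 + 1, k.2) ∉ H →
        (fun t : ℝ ↦ (x (k.1 + 1) : ℂ) + t * I) '' Icc (y k.2) (y (k.2 + 1)) ⊆ U) ∧
      ∃ k ∈ H, p ∈ Ioo (x k.1) (x (k.1 + 1)) ×ℂ Ioo (y k.2) (y (k.2 + 1)) := by
  -- a thickening of the circle inside `U`, the mesh, the grid off `T`
  obtain ⟨η, hη, hηU⟩ := (isCompact_sphere a R).exists_thickening_subset_open hU hSU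
  set δ : ℝ := η / 4 with hδ_def
  have hδ : 0 < δ := by positivity
  have h2δ : 2 * δ < η := by rw [hδ_def]; linarith
  obtain ⟨a₁, a₂, hT₁, hT₂⟩ := exists_grid_avoiding hT δ
  set x : ℤ → ℝ := fun m ↦ a₁ + δ * m with hx_def
  set y : ℤ → ℝ := fun n ↦ a₂ + δ * n with hy_def
  have hx : ∀ m, x m = a₁ + δ * m := fun _ ↦ rfl
  have hy : ∀ n, y n = a₂ + δ * n := fun _ ↦ rfl
  have hxle : ∀ m, x m ≤ x (m + 1) := grid_le_succ hx hδ.le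
  have hyle : ∀ n, y n ≤ y (n + 1) := grid_le_succ hy hδ.le
  -- the complex: cells meeting the closed disc, inside a finite box of indices
  set M₁ : ℤ := ⌊(a.re - R - a₁) / δ⌋ - 1 with hM₁
  set M₂ : ℤ := ⌈(a.re + R - a₁) / δ⌉ with hM₂
  set N₁ : ℤ := ⌊(a.im - R - a₂) / δ⌋ - 1 with hN₁
  set N₂ : ℤ := ⌈(a.im + R - a₂) / δ⌉ with hN₂
  set H : Finset (ℤ × ℤ) := (Finset.Icc M₁ M₂ ×ˢ Finset.Icc N₁ N₂).filter fun k ↦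
    ((Icc (x k.1) (x (k.1 + 1)) ×ℂ Icc (y k.2) (y (k.2 + 1))) ∩ closedBall a R).Nonempty with hH_def
  have hbox : ∀ k : ℤ × ℤ,
      ((Icc (x k.1) (x (k.1 + 1)) ×ℂ Icc (y k.2) (y (k.2 + 1))) ∩ closedBall a R).Nonempty →
        k ∈ Finset.Icc M₁ M₂ ×ˢ Finset.Icc N₁ N₂ := by
    rintro k ⟨w, hwk, hwa⟩
    rw [mem_reProdIm, mem_Icc, mem_Icc, hx, hx, hy, hy] at hwk
    push_cast at hwk
    rw [mem_closedBall, dist_eq_norm] at hwa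
    have hre : |w.re - a.re| ≤ R := (abs_re_le_norm (w - a)).trans (by simpa using hwa)
    have him : |w.im - a.im| ≤ R := (abs_im_le_norm (w - a)).trans (by simpa using hwa)
    rw [abs_le] at hre him
    have key : ∀ {s lo hi : ℝ} {j : ℤ}, s + δ * j ≤ hi → lo ≤ s + δ * (j + 1) →
        ⌊(lo - s) / δ⌋ - 1 ≤ j ∧ j ≤ ⌈(hi - s) / δ⌉ := by
      intro s lo hi j h1 h2
      constructor
      · have h3 : (lo - s) / δ ≤ (j : ℝ) + 1 := by rw [div_le_iff₀ hδ]; linarith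
        have h4 : (⌊(lo - s) / δ⌋ : ℝ) ≤ (j : ℝ) + 1 := (Int.floor_le _).trans h3
        have h5 : ⌊(lo - s) / δ⌋ ≤ j + 1 := by exact_mod_cast h4
        linarith
      · have h3 : (j : ℝ) ≤ (hi - s) / δ := by rw [le_div_iff₀ hδ]; linarith
        have h4 : (j : ℝ) ≤ (⌈(hi - s) / δ⌉ : ℝ) := h3.trans (Int.le_ceil _)
        exact_mod_cast h4
    have k1 := key (s := a₁) (lo := a.re - R) (hi := a.re + R) (j := k.1)
      (by linarith [hwk.1.1]) (by linarith [hwk.1.2])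
    have k2 := key (s := a₂) (lo := a.im - R) (hi := a.im + R) (j := k.2)
      (by linarith [hwk.2.1]) (by linarith [hwk.2.2])
    rw [Finset.mem_product, Finset.mem_Icc, Finset.mem_Icc]
    exact ⟨⟨by rw [hM₁]; convert k1.1 using 2, by rw [hM₂]; convert k1.2 using 2⟩,
      ⟨by rw [hN₁]; convert k2.1 using 2, by rw [hN₂]; convert k2.2 using 2⟩⟩
  have hHmem : ∀ k : ℤ × ℤ, k ∈ H ↔
      ((Icc (x k.1) (x (k.1 + 1)) ×ℂ Icc (y k.2) (y (k.2 + 1))) ∩ closedBall a R).Nonempty := by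
    intro k
    rw [hH_def, Finset.mem_filter]
    exact ⟨fun h ↦ h.2, fun h ↦ ⟨hbox k h, h⟩⟩
  -- cells of `H` lie in `closedBall a R ∪ (R ≤ dist < R + η) ⊆ closedBall a R ∪ U`; cells off `H`
  -- miss the closed disc
  have hin : ∀ k ∈ H, ∀ z ∈ Icc (x k.1) (x (k.1 + 1)) ×ℂ Icc (y k.2) (y (k.2 + 1)),
      R ≤ dist z a → z ∈ U := by
    intro k hk z hz hRz
    obtain ⟨w, hwk, hwa⟩ := (hHmem k).1 hk
    have hzw : dist z w ≤ 2 * δ := dist_le_of_mem_cell hx hy hz hwk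
    rw [mem_closedBall] at hwa
    have hza : dist z a < R + η := by linarith [dist_triangle z w a]
    exact mem_of_thickening_sphere_subset hR hηU hRz hza
  have hcell : ∀ k ∈ H, Icc (x k.1) (x (k.1 + 1)) ×ℂ Icc (y k.2) (y (k.2 + 1)) ⊆
      closedBall a R ∪ U := by
    intro k hk z hz
    rcases le_or_gt (dist z a) R with h | h
    · exact Or.inl (mem_closedBall.2 h)
    · exact Or.inr (hin k hk z hz h.le)
  have hout : ∀ k : ℤ × ℤ, k ∉ H → ∀ z ∈ Icc (x k.1) (x (k.1 + 1)) ×ℂ Icc (y k.2) (y (k.2 + 1)),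
      R ≤ dist z a := by
    intro k hk z hz
    by_contra hlt
    exact hk ((hHmem k).2 ⟨z, hz, mem_closedBall.2 (not_le.1 hlt).le⟩)
  have hedge : ∀ k ∈ H, ∀ k' : ℤ × ℤ, k' ∉ H → ∀ z : ℂ,
      z ∈ Icc (x k.1) (x (k.1 + 1)) ×ℂ Icc (y k.2) (y (k.2 + 1)) →
      z ∈ Icc (x k'.1) (x (k'.1 + 1)) ×ℂ Icc (y k'.2) (y (k'.2 + 1)) → z ∈ U :=
    fun k hk k' hk' z hz hz' ↦ hin k hk z hz (hout k' hk' z hz')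
  -- the pole `p` sits in the open cell of its index, which belongs to `H`
  set kp : ℤ × ℤ := (⌊(p.re - a₁) / δ⌋, ⌊(p.im - a₂) / δ⌋) with hkp
  have hpcell : p ∈ Icc (x kp.1) (x (kp.1 + 1)) ×ℂ Icc (y kp.2) (y (kp.2 + 1)) :=
    mem_cell_floor hx hy hδ p
  have hpcello : p ∈ Ioo (x kp.1) (x (kp.1 + 1)) ×ℂ Ioo (y kp.2) (y (kp.2 + 1)) :=
    (mem_cello_of_not_mem_lines (hT₁ p hpT) (hT₂ p hpT) kp).resolve_right
      (fun h ↦ h hpcell)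
  have hkpH : kp ∈ H := (hHmem kp).2 ⟨p, hpcell, mem_closedBall.2 hpa.le⟩
  refine ⟨x, y, H, hxle, hyle, hcell, fun q hq k ↦ mem_cello_of_not_mem_lines (hT₁ q hq) (hT₂ q hq) k,
    ?_, ?_, ?_, ?_, kp, hkpH, hpcello⟩
  · -- bottom edges
    rintro k hk hk' _ ⟨t, ht, rfl⟩
    refine hedge k hk _ hk' _ ?_ ?_
    · simpa [mem_reProdIm] using ⟨ht, hyle k.2⟩
    · have e : y (k.2 - 1 + 1) = y k.2 := by rw [sub_add_cancel]
      have h1 : y (k.2 - 1) ≤ y k.2 := by simpa [sub_add_cancel] using hyle (k.2 - 1)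
      simpa [mem_reProdIm, e] using ⟨ht, h1⟩
  · -- top edges
    rintro k hk hk' _ ⟨t, ht, rfl⟩
    refine hedge k hk _ hk' _ ?_ ?_
    · simpa [mem_reProdIm] using ⟨ht, hyle k.2⟩
    · simpa [mem_reProdIm] using ⟨ht, hyle (k.2 + 1)⟩
  · -- left edges
    rintro k hk hk' _ ⟨t, ht, rfl⟩
    refine hedge k hk _ hk' _ ?_ ?_
    · simpa [mem_reProdIm] using ⟨hxle k.1, ht⟩
    · have e : x (k.1 - 1 + 1) = x k.1 := by rw [sub_add_cancel]
      have h1 : x (k.1 - 1) ≤ x k.1 := by simpa [sub_add_cancel] using hxle (k.1 - 1)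
      simpa [mem_reProdIm, e] using ⟨h1, ht⟩
  · -- right edges
    rintro k hk hk' _ ⟨t, ht, rfl⟩
    refine hedge k hk _ hk' _ ?_ ?_
    · simpa [mem_reProdIm] using ⟨hxle k.1, ht⟩
    · simpa [mem_reProdIm] using ⟨hxle (k.1 + 1), ht⟩

end Summit.RiemannHypothesis.RiemannHypothesis.Theorems.Splittings.ScrewDust

/-! ## 2. The cycle row `CEIL(h) ∧ CENC(h) ⟺ RH` -/

namespace Summit.RiemannHypothesis.RiemannHypothesis.Theorems.Splittings.ScrewLatticeCycleGauss

open Complex Filter Topology Set Metric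
open Literature.NumberTheory.LFunctions
open Summit.RiemannHypothesis.RiemannHypothesis.Theorems.Splittings
open Summit.RiemannHypothesis.RiemannHypothesis.Theorems.Splittings.ScrewBorel
open Summit.RiemannHypothesis.RiemannHypothesis.Theorems.Splittings.ScrewBorelFlux
open Summit.RiemannHypothesis.RiemannHypothesis.Theorems.Splittings.ScrewBorelGauss
open Summit.RiemannHypothesis.RiemannHypothesis.Theorems.Splittings.ScrewLatticeContinuation
open Summit.RiemannHypothesis.RiemannHypothesis.Theorems.Splittings.ScrewLatticeThinWall
open Summit.RiemannHypothesis.RiemannHypothesis.Theorems.Splittings.ScrewLatticeGauss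
open Summit.RiemannHypothesis.RiemannHypothesis.Theorems.Splittings.ScrewDust

/-- `CENC(h)` («cycle-encirclable»): if there are aliased far zeros in `𝔻` at all, then some GRID
CYCLE of the origin's component `Ω₀(h)` of `𝔻 ∖ T_h` encloses one — there are a grid `x, y : ℤ → ℝ`
(non-decreasing) and a finite complex `H` of its closed cells `[x m, x (m+1)] × [y n, y (n+1)]` inside
`𝔻`, in general position (each aliased zero `u_ρ^{±1}` in an open cell or off the closed cell of every
cell of `H`), all of whose EXPOSED edges (bottom edge of a cell of `H` with no cell of `H` below it,
etc.) lie in `Ω₀(h)`, with an aliased far zero in an OPEN cell of `H`.  Open; RH-implied (vacuously,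
`cycleEncirclable_of_rh`); implied by `ENC(h)` (`cycleEncirclable_of_encirclable`), hence by
`LASSO(h)`, `TW(h)`, `CC(h)`. -/
@[conjecture] def CycleEncirclable (h : ℝ) : Prop :=
  (aliasedPoleSet h).Nonempty → ∃ (x y : ℤ → ℝ) (H : Finset (ℤ × ℤ)),
    (∀ m, x m ≤ x (m + 1)) ∧ (∀ n, y n ≤ y (n + 1)) ∧
    (∀ k ∈ H, Icc (x k.1) (x (k.1 + 1)) ×ℂ Icc (y k.2) (y (k.2 + 1)) ⊆ ball (0 : ℂ) 1) ∧
    (∀ ρ : ZetaZeros.riemannZetaNontrivialZeros, ∀ k ∈ H, ∀ q : ℂ,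
      q = mult h ρ ∨ q = (mult h ρ)⁻¹ →
        q ∈ Ioo (x k.1) (x (k.1 + 1)) ×ℂ Ioo (y k.2) (y (k.2 + 1)) ∨
          q ∉ Icc (x k.1) (x (k.1 + 1)) ×ℂ Icc (y k.2) (y (k.2 + 1))) ∧
    (∀ k ∈ H, (k.1, k.2 - 1) ∉ H →
      (fun t : ℝ ↦ (t : ℂ) + y k.2 * I) '' Icc (x k.1) (x (k.1 + 1)) ⊆ originComponent h) ∧
    (∀ k ∈ H, (k.1, k.2 + 1) ∉ H →
      (fun t : ℝ ↦ (t : ℂ) + y (k.2 + 1) * I) '' Icc (x k.1) (x (k.1 + 1)) ⊆ originComponent h) ∧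
    (∀ k ∈ H, (k.1 - 1, k.2) ∉ H →
      (fun t : ℝ ↦ (x k.1 : ℂ) + t * I) '' Icc (y k.2) (y (k.2 + 1)) ⊆ originComponent h) ∧
    (∀ k ∈ H, (k.1 + 1, k.2) ∉ H →
      (fun t : ℝ ↦ (x (k.1 + 1) : ℂ) + t * I) '' Icc (y k.2) (y (k.2 + 1)) ⊆ originComponent h) ∧
    ∃ p ∈ aliasedPoleSet h, ∃ k ∈ H, p ∈ Ioo (x k.1) (x (k.1 + 1)) ×ℂ Ioo (y k.2) (y (k.2 + 1))

/-- **RH ⟹ CENC(h)** (vacuously: no aliased far zeros). -/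
theorem cycleEncirclable_of_rh (hRH : RiemannHypothesis) (h : ℝ) : CycleEncirclable h := by
  intro hne
  rw [aliasedPoleSet_eq_empty_of_rh hRH] at hne
  exact absurd hne Set.not_nonempty_empty

/-- **`CEIL(h) ∧ CENC(h) ⟹` no aliased far zeros** (`h > 0`): Gauss's law for grid cycles. -/
theorem aliasedPoleSet_eq_empty_of_latticeCeiling_of_cycleEncirclable {h : ℝ} (hh : 0 < h)
    (hceil : LatticeCeiling h) (henc : CycleEncirclable h) : aliasedPoleSet h = ∅ := by
  rcases Set.eq_empty_or_nonempty (aliasedPoleSet h) with h0 | hne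
  · exact h0
  obtain ⟨x, y, H, hx, hy, hH, hoff, hbot, htop, hlef, hrig, p, hp, k, hk, hpk⟩ := henc hne
  exfalso
  exact false_of_cellComplex (c := coeff) (u := mult h) summable_norm_coeff re_coeff_neg
    (mult_ne_zero h) (differentiableOn_latticeGF hceil) (Real.exp_pos (-(h / 2)))
    (fun _ hq ↦ exp_neg_half_le_norm_of_mem hh.le hq)
    (fun _ hz ↦ latticeGF_eq_borel hh (mem_ball_zero_iff.1 hz)) (isPreconnected_originComponent h)
    (zero_mem_originComponent hh.le) (originComponent_subset h) hx hy hH hoff hbot htop hlef hrig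
    hp hk hpk

/-- **`CEIL(h) ∧ CENC(h) ⟹ RH`** (`h > 0`). -/
theorem rh_of_latticeCeiling_of_cycleEncirclable {h : ℝ} (hh : 0 < h) (hceil : LatticeCeiling h)
    (henc : CycleEncirclable h) : RiemannHypothesis := by
  by_contra hnot
  have hne := aliasedPoleSet_nonempty_of_not_rh hh hnot
  rw [aliasedPoleSet_eq_empty_of_latticeCeiling_of_cycleEncirclable hh hceil henc] at hne
  exact Set.not_nonempty_empty hne

/-- **THE CYCLE ROW (the splitting)**, `h > 0` arbitrary: `CEIL(h) ∧ CENC(h) ↔ RiemannHypothesis`. -/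
theorem latticeCeiling_and_cycleEncirclable_iff_rh {h : ℝ} (hh : 0 < h) :
    (LatticeCeiling h ∧ CycleEncirclable h) ↔ RiemannHypothesis :=
  ⟨fun hab ↦ rh_of_latticeCeiling_of_cycleEncirclable hh hab.1 hab.2,
    fun hRH ↦ ⟨latticeCeiling_of_rh hRH h, cycleEncirclable_of_rh hRH h⟩⟩

/-- **THE DICHOTOMY (RH-free content)**, `h > 0`: under `CEIL(h)`, EITHER the Riemann hypothesis holds
OR there are aliased far zeros in `𝔻` and NO wall-free grid cycle of `Ω₀(h)` encloses one (the wall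
`T_h` cuts every far zero off from every grid cycle linked to the origin — not only from every circle). -/
theorem latticeCeiling_dichotomy_cycles {h : ℝ} (hh : 0 < h) (hceil : LatticeCeiling h) :
    RiemannHypothesis ∨ ((aliasedPoleSet h).Nonempty ∧ ¬ CycleEncirclable h) := by
  by_cases hRH : RiemannHypothesis
  · exact Or.inl hRH
  · refine Or.inr ⟨aliasedPoleSet_nonempty_of_not_rh hh hRH, fun henc ↦ hRH ?_⟩
    exact rh_of_latticeCeiling_of_cycleEncirclable hh hceil henc

/-! ## 3. Circles are grid cycles: `ENC(h) ⟹ CENC(h)`, hence `LASSO`, `TW`, `CC` -/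

/-- `Ω₀(h)` is open (a component of the open set `𝔻 ∖ T_h`). -/
theorem isOpen_originComponent (h : ℝ) : IsOpen (originComponent h) :=
  (isOpen_ball.sdiff isClosed_closure).connectedComponentIn

/-- The set of all aliased zeros `u_ρ`, `u_ρ⁻¹` (inside the disc or not) is countable. -/
theorem countable_mults (h : ℝ) :
    {q : ℂ | ∃ ρ : ZetaZeros.riemannZetaNontrivialZeros, q = mult h ρ ∨ q = (mult h ρ)⁻¹}.Countable := by
  haveI : Countable ZetaZeros.riemannZetaNontrivialZeros :=
    countable_of_summable_of_re_neg summable_norm_coeff re_coeff_neg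
  have e : {q : ℂ | ∃ ρ : ZetaZeros.riemannZetaNontrivialZeros, q = mult h ρ ∨ q = (mult h ρ)⁻¹} =
      Set.range (mult h) ∪ Set.range (fun ρ ↦ (mult h ρ)⁻¹) := by
    ext q
    simp only [mem_setOf_eq, mem_union, mem_range]
    constructor
    · rintro ⟨ρ, h1 | h1⟩
      · exact Or.inl ⟨ρ, h1.symm⟩
      · exact Or.inr ⟨ρ, h1.symm⟩
    · rintro (⟨ρ, h1⟩ | ⟨ρ, h1⟩)
      · exact ⟨ρ, Or.inl h1.symm⟩
      · exact ⟨ρ, Or.inr h1.symm⟩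
  rw [e]
  exact (Set.countable_range _).union (Set.countable_range _)

/-- **ENC(h) ⟹ CENC(h)**: a circle of `Ω₀(h)` enclosing an aliased far zero is shadowed by a grid
cycle of `Ω₀(h)` enclosing it (the cycle row contains row X-14). -/
theorem cycleEncirclable_of_encirclable {h : ℝ} (henc : Encirclable h) : CycleEncirclable h := by
  intro hne
  obtain ⟨a, R, hR, haR, hS, p, hp, hpa⟩ := henc hne
  have hpT : p ∈ {q : ℂ | ∃ ρ : ZetaZeros.riemannZetaNontrivialZeros,
      q = mult h ρ ∨ q = (mult h ρ)⁻¹} := hp.2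
  obtain ⟨x, y, H, hx, hy, hcell, hgp, hbot, htop, hlef, hrig, k, hk, hpk⟩ :=
    exists_cellComplex_of_sphere (countable_mults h) (isOpen_originComponent h) hR hS hpT
      (mem_ball.1 hpa)
  refine ⟨x, y, H, hx, hy, fun k hk ↦ (hcell k hk).trans ?_, fun ρ k _ q hq ↦ hgp q ⟨ρ, hq⟩ k,
    hbot, htop, hlef, hrig, p, hp, k, hk, hpk⟩
  exact union_subset haR fun z hz ↦ (originComponent_subset h hz).1

/-- **LASSO(h) ⟹ CENC(h)**. -/
theorem cycleEncirclable_of_lasso {h : ℝ} (hl : Lasso h) : CycleEncirclable h :=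
  cycleEncirclable_of_encirclable (encirclable_of_lasso hl)

/-- **TW(h) ⟹ CENC(h)** (`h ≥ 0`): the cycle row contains row X-10. -/
theorem cycleEncirclable_of_thinWall {h : ℝ} (hh : 0 ≤ h) (htw : ThinWall h) : CycleEncirclable h :=
  cycleEncirclable_of_encirclable (encirclable_of_thinWall hh htw)

/-- **CC(h) ⟹ CENC(h)** (`h ≥ 0`): the cycle row contains row X-9. -/
theorem cycleEncirclable_of_countableClosure {h : ℝ} (hh : 0 ≤ h) (hcc : CountableClosure h) :
    CycleEncirclable h :=
  cycleEncirclable_of_thinWall hh (thinWall_of_countableClosure hcc)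

end Summit.RiemannHypothesis.RiemannHypothesis.Theorems.Splittings.ScrewLatticeCycleGauss
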